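import Mathlib
import HarnessLib.Audit
import Summits.PneNP.PneNP.Theorems.PstarGateCasePNor
import Summits.PneNP.PneNP.Theorems.PstarGateCasePNorCount
import Summits.PneNP.PneNP.Theorems.PstarGateCasePNorCountCycle
import Summits.PneNP.PneNP.Theorems.PstarGateFibreRank

/-!
# One GATED chord, node N1 CLOSED: CASE P with a (NOR) chord is EMPTY — `gateCasePNorX_holds` (E2; prover-1 g19)

FRONTIER range-avoidance ladder, rung F-N3 (`stmt-PneNP-19007`), cell `pnp-ideate` (`PstarGateNodesX.GateCasePNorX`; predecessor seat's
`HOME/pnp-ideate-prover-1/g18/E2-PLAN-v3.md` §8); restricted-model proof complexity — nothing here bears on `P` versus `NP`.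

The assembly of node N1 of the E2 chain from the pieces landed by prover-1 g18.  CASE P (`ReadAlong (1,0)`) one-gate bridge data on an
XOR-closed core (`GateDataX`) with SOME other chord (NOR) w.r.t. `q = q_{(1,0)}`:
1. EVERY other chord is (NOR) (`PstarGateCasePRegimes.caseP_regimes`; its (EQ)/unit alternative is killed by the given (NOR) chord through
   `not_EQ_of_nor_dir` / `false_of_nor_of_excUnit`, as inside `caseP_regimes`);
2. each other chord `e'` has a CONS-T pair `D e' = {j₁, j₂}` (`caseP_nor_structure`), the fundamental sets of distinct chords are distinct
   (`eq_of_fundamental_eq`), `#D e ≥ 2` (`two_le_card_of_even`); so the unit bound `#((N − e) ∪ ⋃ D e') ≤ 5` (`caseP_nor_units`) gives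
   `a := #(N − e) ≤ 2`;
3. the boundary count `#(J₀ ∖ N) ≤ a + 1` (`caseP_nor_count`) kills `a = 1` (`J₀ ∖ N ⊇ D e ∪ D e₁` has ≥ 3 members) and for `a = 2` forces
   `J₀ ∖ N = D e₁ ∪ D e₂` of size three; `D e = J₀ ∖ N` is the cycle count's exclusion (`caseP_nor_count_cycle`), so `#D e = 2`;
4. the literal pair `{σ, τ}` is cert-independent (`caseP_nor_structure`: `v` literal iff `q` is not `e_v`-invariant), so both CONS-T pairs carry
   the same literals, one per edge; they share one edge, hence its literal, and the two remaining edges both hold the other literal `λ`;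
   `D e` (≠ both pairs, size two, inside their union) is those two edges — an XOR-matching through `λ`, against
   `PstarGateFibreRank.avoid_nonempty` (`false_of_shared_edge`).
Hence `caseP_nor_false` (the configuration does not exist) and **`gateCasePNorX_holds : GateCasePNorX`**.  E2 open surface after this file:
N2X, N3X, N4X, N5X, N6X (N6′X closed in `PstarGateUnitCycleAffine`).
-/

set_option linter.dupNamespace false -- `Summit.PneNP.PneNP.…`: summit = sub-problem name (D-0017 single-conjunct layout)

open Finset Literature.Computability.Complexity
open Summit.PneNP.PneNP.Theorems.PstarTyped (Typed)
open Summit.PneNP.PneNP.Theorems.PstarSALevel (BoundaryExpanding SimpleOverlap)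
open Summit.PneNP.PneNP.Theorems.PstarGapLinearised (andPair)
open Summit.PneNP.PneNP.Theorems.PstarChordEndgameTools (mem_andPair_iff)
open Summit.PneNP.PneNP.Theorems.PstarPathRankFibre (avoid)
open Summit.PneNP.PneNP.Theorems.PstarReadSumset (V2)
open Summit.PneNP.PneNP.Theorems.PstarChordSystem (ChordSystem)
open Summit.PneNP.PneNP.Theorems.PstarChordBridgeTools (xpdeg)
open Summit.PneNP.PneNP.Theorems.PstarChordBridge (BridgeData sys Solution)
open Summit.PneNP.PneNP.Theorems.PstarChordBridgeForcing (gam)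
open Summit.PneNP.PneNP.Theorems.PstarChordBridgeBasis (qDir polarDir)
open Summit.PneNP.PneNP.Theorems.PstarChordBridgeFundamental (two_le_card_of_even eq_of_fundamental_eq)
open Summit.PneNP.PneNP.Theorems.PstarNorUnitDirAssembly (not_EQ_of_nor_dir)
open Summit.PneNP.PneNP.Theorems.PstarNorUnitMixed (false_of_nor_of_excUnit)
open Summit.PneNP.PneNP.Theorems.PstarGateBridge (GateHyp)
open Summit.PneNP.PneNP.Theorems.PstarGateCasePRegimes (NorCert EqCert UnitCert caseP_regimes)
open Summit.PneNP.PneNP.Theorems.PstarGateCasePNor (caseP_nor_units)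
open Summit.PneNP.PneNP.Theorems.PstarGateNodes (GateData ReadAlong AllRead)
open Summit.PneNP.PneNP.Theorems.PstarGateNodesX (GateDataX GateCasePNorX)
open Summit.PneNP.PneNP.Theorems.PstarGateCasePNorJoins (caseP_nor_structure)
open Summit.PneNP.PneNP.Theorems.PstarGateCasePNorCount (caseP_nor_count)
open Summit.PneNP.PneNP.Theorems.PstarGateCasePNorCountCycle (caseP_nor_count_cycle)
open Summit.PneNP.PneNP.Theorems.PstarGateFibreRank (avoid_nonempty)

namespace Summit.PneNP.PneNP.Theorems.PstarGateCasePNorFinal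

variable {n m : ℕ}

/-- **The literal endgame.**  Three tree edges `s, j, k` with a common literal `λ ∈ j, k` (AND slots); a fundamental set `D` (of a chord `e`)
inside `{s, j, k}`, of size two and different from `{s, j}` and `{s, k}`, is `{j, k}` up to size — an XOR-matching through `λ`, which
`PstarGateFibreRank.avoid_nonempty` forbids. -/
theorem false_of_shared_edge (I : LocalMap 4 n m) (hI : I.IsPure xorAndPred) (hS : SimpleOverlap I) {D : Finset (Fin m)} {e : Fin m}
    (heD : e ∉ D) (heven : ∀ w, Even (xpdeg I (insert e D) w)) {s j k : Fin m} {l : Fin n}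
    (hlj : l ∈ andPair I j) (hlk : l ∈ andPair I k)
    (hsub : D ⊆ {s, j, k}) (hcard : D.card = 2) (hne₁ : D ≠ {s, j}) (hne₂ : D ≠ {s, k}) : False := by
  classical
  -- the shared edge is not in `D`
  have hs : s ∉ D := by
    intro hsD
    obtain ⟨x, hx, hxs⟩ : ∃ x ∈ D, x ≠ s := by
      by_contra h
      push Not at h
      have h1 : D ⊆ {s} := fun x hx => mem_singleton.2 (h x hx)
      have h2 := card_le_card h1
      rw [card_singleton] at h2
      omega
    have hpair : ∀ y, y ∈ D → y ≠ s → D = {s, y} := fun y hy hys =>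
      (eq_of_subset_of_card_le (insert_subset hsD (singleton_subset_iff.2 hy)) (by rw [card_pair (Ne.symm hys), hcard])).symm
    have hx' := hsub hx
    simp only [mem_insert, mem_singleton] at hx'
    rcases hx' with h | h | h
    · exact hxs h
    · exact hne₁ (h ▸ hpair x hx hxs)
    · exact hne₂ (h ▸ hpair x hx hxs)
  -- so every edge of `D` holds `λ`: no edge avoids it
  obtain ⟨t, ht⟩ := avoid_nonempty I hI hS heD heven l
  unfold PstarPathRankFibre.avoid at ht
  obtain ⟨htD, h2, h3⟩ := mem_filter.1 ht
  rw [mem_singleton] at h2 h3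
  have hlt : l ∈ andPair I t := by
    have h := hsub htD
    simp only [mem_insert, mem_singleton] at h
    rcases h with rfl | rfl | rfl
    · exact absurd htD hs
    · exact hlj
    · exact hlk
  rcases (mem_andPair_iff I t l).1 hlt with h | h
  · exact h2 h.symm
  · exact h3 h.symm

/-- **Node N1 is EMPTY**: CASE P one-gate bridge data on an XOR-closed core with some other chord (NOR) w.r.t. `q_{(1,0)}` do not exist. -/
theorem caseP_nor_false (I : LocalMap 4 n m) (hI : I.IsPure xorAndPred) (hT : Typed I) (hS : SimpleOverlap I) {r : ℕ}
    (hB : BoundaryExpanding r I) {B : BridgeData n m} {e g₀ : Fin m} {u : Fin n} {κ₀ : ZMod 2} (hD : GateDataX I r B e g₀ u κ₀)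
    (hRA : ReadAlong I B e (1, 0)) (hread : AllRead I B e) (hNOR : ∃ e' ∈ B.N, e' ≠ e ∧ NorCert I B (B.D e') (gam B e')) : False := by
  classical
  obtain ⟨hXc, hW, hr, hd₁, hd₂, hL, hPe, -, hG, hg₀, hgv, hju, hup, hux, hG₁p, hcoef, hT3, hM0⟩ := id hD
  have he : e ∈ B.N := hG.1
  have hg₀J : g₀ ∉ B.J₀ := fun h => disjoint_left.1 hd₁ hg₀ h
  have hJR : B.J₀ ⊆ B.J₀ ∪ B.G₁ ∪ B.G₂ := subset_union_left.trans subset_union_left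
  have hJr : B.J₀.card ≤ r := (card_le_card hJR).trans hr
  have hJr' : B.J₀.card < r :=
    lt_of_lt_of_le (card_lt_card ⟨hJR, fun h => hg₀J (h (mem_union_left _ (mem_union_right _ hg₀)))⟩) hr
  have hM0N : ∀ f ∈ B.N, ∃ z, Solution I B (B.J₀.erase f) z := fun f hf => hM0 f (hW.hN hf)
  -- CASE P data in pointwise form
  have hP : ∀ e' ∈ B.N, e' ≠ e → ∀ a, ((sys I B).ρ e' a).2 = 0 ∧ ((sys I B).ρ' e' a).2 = 0 := by
    intro i hi hie x
    obtain ⟨h1, h2⟩ := hRA i hi hie x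
    constructor
    · rcases h1 with h | h
      · rw [h]; rfl
      · rw [h]
    · rcases h2 with h | h
      · rw [h]; rfl
      · rw [h]
  obtain ⟨e₁, he₁, hne₁, hnor₁⟩ := hNOR
  have hne : (B.N.erase e).Nonempty := ⟨e₁, mem_erase.2 ⟨hne₁, he₁⟩⟩
  -- (1) every other chord is (NOR)
  have hall : ∀ e' ∈ B.N, e' ≠ e → NorCert I B (B.D e') (gam B e') := by
    rcases caseP_regimes I hI hT hS hB hW hr hd₁ hd₂ hL hG hg₀ hgv hup hux hG₁p hT3 hM0N hP with h | ⟨hEU, -, -, -⟩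
    · exact h
    · exfalso
      obtain ⟨a, b, -, hq₁, -⟩ := hnor₁
      rcases hEU e₁ he₁ hne₁ with ⟨κ, hκ⟩ | ⟨j₁, j₂, σ, τ, -, hDe, hdisj, hσ, hτ, hform⟩
      · exact not_EQ_of_nor_dir I hI hS hB hW hJr (1, 0) hq₁ he₁ hκ
      · exact false_of_nor_of_excUnit I hI hDe hdisj hσ hτ hform (ζ := 1) hq₁
  -- (2)/(3) the unit bound and the two boundary counts
  obtain ⟨h5, -⟩ := caseP_nor_units I hI hT hS hB hW hr hJr' hd₁ hd₂ hG g₀ hux true hne hall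
  obtain ⟨g, -, hcount⟩ := caseP_nor_count I hI hT hS hB hD hRA hread hall hne
  obtain ⟨-, -, hcyc⟩ := caseP_nor_count_cycle I hI hT hS hB hD hRA hread hall hne
  have hδ : (if g ∈ B.J₀ then 0 else 1) ≤ 1 := by split_ifs <;> omega
  set T := B.J₀ \ B.N with hTdef
  set A := B.N.erase e with hA
  -- fundamental sets: inside `T`, pairwise distinct, `#D e ≥ 2`, the others CONS-T pairs
  have hDT : ∀ f ∈ B.N, B.D f ⊆ T := fun f hf => hW.hD f hf
  have hnotD : ∀ f ∈ B.N, ∀ f' ∈ B.N, f' ∉ B.D f := fun f hf f' hf' h => (mem_sdiff.1 (hW.hD f hf h)).2 hf'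
  have hDinj : ∀ f ∈ B.N, ∀ f' ∈ B.N, B.D f = B.D f' → f = f' := by
    intro f hf f' hf' hDD
    have hev' : ∀ w, Even (xpdeg I (insert f' (B.D f)) w) := fun w => by rw [hDD]; exact hW.hDeven f' hf' w
    exact eq_of_fundamental_eq I hI hS (hnotD f hf f hf) (hnotD f hf f' hf') (hW.hDeven f hf) hev'
  have heDe : e ∉ B.D e := hnotD e he e he
  have hevE : ∀ w, Even (xpdeg I (insert e (B.D e)) w) := hW.hDeven e he
  have h2e : 2 ≤ (B.D e).card := two_le_card_of_even I hI hS heDe hevE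
  have hpair : ∀ f ∈ A, (B.D f).card = 2 := by
    intro f hf
    obtain ⟨hfe, hfN⟩ := mem_erase.1 hf
    obtain ⟨j₁, j₂, σ, τ, hne12, hDf, -⟩ := caseP_nor_structure I hI hT hS hB hD hRA hread hfN (hall f hfN hfe)
    rw [hDf, card_pair hne12]
  -- two distinct sets, one of size two and one of size at least two, have a union of size at least three
  have hunion : ∀ {P Q : Finset (Fin m)}, 2 ≤ P.card → Q.card = 2 → P ≠ Q → 3 ≤ (P ∪ Q).card := by
    intro P Q hP hQ hPQ
    by_contra hlt
    have h1 : P = P ∪ Q := eq_of_subset_of_card_le subset_union_left (by omega)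
    have h2 : Q = P ∪ Q := eq_of_subset_of_card_le subset_union_right (by omega)
    exact hPQ (h1.trans h2.symm)
  -- the unit family splits as chords + tree edges
  have hAU : Disjoint A (A.biUnion B.D) := by
    rw [disjoint_left]
    intro f hf hf'
    obtain ⟨f', hf'A, hff'⟩ := mem_biUnion.1 hf'
    exact hnotD f' (mem_of_mem_erase hf'A) f (mem_of_mem_erase hf) hff'
  rw [card_union_of_disjoint hAU] at h5
  have hA1 : 1 ≤ A.card := card_pos.2 hne
  rcases Nat.lt_or_ge A.card 2 with hlt | hge
  · -- `a = 1`: `T ⊇ D e ∪ D e₁` has at least three members, the count allows two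
    obtain ⟨f, hAf⟩ := card_eq_one.1 (show A.card = 1 by omega)
    have hfA : f ∈ A := by rw [hAf]; exact mem_singleton_self _
    obtain ⟨hfe, hfN⟩ := mem_erase.1 hfA
    have h3 : 3 ≤ (B.D e ∪ B.D f).card := hunion h2e (hpair f hfA) (fun h => hfe (hDinj e he f hfN h).symm)
    have hTge : 3 ≤ T.card := h3.trans (card_le_card (union_subset (hDT e he) (hDT f hfN)))
    rw [hAf, card_singleton] at hcount
    omega
  · -- `a ≥ 2`: two distinct other chords `f₁ ≠ f₂`; the unit bound gives `a = 2`
    obtain ⟨f₁, hf₁, f₂, hf₂, hf12⟩ := one_lt_card.1 (show 1 < A.card by omega)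
    obtain ⟨hf₁e, hf₁N⟩ := mem_erase.1 hf₁
    obtain ⟨hf₂e, hf₂N⟩ := mem_erase.1 hf₂
    have hD12 : B.D f₁ ≠ B.D f₂ := fun h => hf12 (hDinj f₁ hf₁N f₂ hf₂N h)
    have h3 : 3 ≤ (B.D f₁ ∪ B.D f₂).card := hunion (by rw [hpair f₁ hf₁]) (hpair f₂ hf₂) hD12
    have hsubU : B.D f₁ ∪ B.D f₂ ⊆ A.biUnion B.D :=
      union_subset (subset_biUnion_of_mem B.D hf₁) (subset_biUnion_of_mem B.D hf₂)
    have hbU : 3 ≤ (A.biUnion B.D).card := h3.trans (card_le_card hsubU)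
    have hA2 : A.card = 2 := by omega
    -- `T = D f₁ ∪ D f₂` has three members, and `#D e = 2` by the cycle count
    have hPT : B.D f₁ ∪ B.D f₂ ⊆ T := union_subset (hDT f₁ hf₁N) (hDT f₂ hf₂N)
    have hTle : T.card ≤ 3 := by rw [hA2] at hcount; omega
    have hTeq : B.D f₁ ∪ B.D f₂ = T := eq_of_subset_of_card_le hPT (by omega)
    have hT3 : T.card = 3 := by rw [← hTeq]; rw [← hTeq] at hTle; omega
    have hDeT : B.D e ⊆ T := hDT e he
    have hDe2 : (B.D e).card = 2 := by
      by_contra hne2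
      have hle : T.card ≤ (B.D e).card := by
        have := card_le_card hDeT; omega
      exact hcyc (eq_of_subset_of_card_le hDeT hle).symm
    -- (4) the CONS-T structure of the two (NOR) chords, with the COMMON literal pair
    obtain ⟨j₁, j₂, σ, τ, hne12, hD₁, hdisj₁, hσ₁, hτ₁, -, hlit₁, -⟩ :=
      caseP_nor_structure I hI hT hS hB hD hRA hread hf₁N (hall f₁ hf₁N hf₁e)
    obtain ⟨k₁', k₂', σ', τ', hne12', hD₂', hdisj₂', hσ₂', hτ₂', -, hlit₂, -⟩ :=
      caseP_nor_structure I hI hT hS hB hD hRA hread hf₂N (hall f₂ hf₂N hf₂e)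
    have hστ : σ ≠ τ := fun h => disjoint_left.1 hdisj₁ hσ₁ (h ▸ hτ₁)
    have hστ' : σ' ≠ τ' := fun h => disjoint_left.1 hdisj₂' hσ₂' (h ▸ hτ₂')
    have hsame : ∀ v, (v = σ' ∨ v = τ') → (v = σ ∨ v = τ) := fun v hv => (hlit₁ v).1 ((hlit₂ v).2 hv)
    -- normalise the second pair: `σ ∈ k₁`, `τ ∈ k₂`
    obtain ⟨k₁, k₂, hD₂, hdisj₂, hσ₂, hτ₂⟩ : ∃ k₁ k₂ : Fin m, B.D f₂ = {k₁, k₂} ∧ Disjoint (andPair I k₁) (andPair I k₂) ∧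
        σ ∈ andPair I k₁ ∧ τ ∈ andPair I k₂ := by
      rcases hsame σ' (Or.inl rfl) with h | h
      · have hτ' : τ' = τ := by
          rcases hsame τ' (Or.inr rfl) with h' | h'
          · exact absurd (h.trans h'.symm) hστ'
          · exact h'
        refine ⟨k₁', k₂', hD₂', hdisj₂', ?_, ?_⟩
        · rw [← h]; exact hσ₂'
        · rw [← hτ']; exact hτ₂'
      · have hτ' : τ' = σ := by
          rcases hsame τ' (Or.inr rfl) with h' | h'
          · exact h'
          · exact absurd (h.trans h'.symm) hστ'
        refine ⟨k₂', k₁', by rw [hD₂', pair_comm], hdisj₂'.symm, ?_, ?_⟩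
        · rw [← hτ']; exact hτ₂'
        · rw [← h]; exact hσ₂'
    have hτk₁ : τ ∉ andPair I k₁ := fun h => disjoint_left.1 hdisj₂ h hτ₂
    have hσk₂ : σ ∉ andPair I k₂ := fun h => disjoint_left.1 hdisj₂ hσ₂ h
    -- the two pairs share an edge `s`
    obtain ⟨s, hs⟩ : (B.D f₁ ∩ B.D f₂).Nonempty := by
      rw [← card_pos]
      have h := card_union_add_card_inter (B.D f₁) (B.D f₂)
      rw [hTeq, hT3, hpair f₁ hf₁, hpair f₂ hf₂] at h
      omega
    obtain ⟨hs₁, hs₂⟩ := mem_inter.1 hs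
    rw [hD₁, mem_insert, mem_singleton] at hs₁
    rw [hD₂, mem_insert, mem_singleton] at hs₂
    have hDe₁ : B.D e ≠ {j₁, j₂} := fun h => hf₁e (hDinj e he f₁ hf₁N (h.trans hD₁.symm)).symm
    have hDe₂ : B.D e ≠ {k₁, k₂} := fun h => hf₂e (hDinj e he f₂ hf₂N (h.trans hD₂.symm)).symm
    have hDeT' : B.D e ⊆ {j₁, j₂} ∪ {k₁, k₂} := by rw [← hD₁, ← hD₂, hTeq]; exact hDeT
    rcases hs₁ with hsj | hsj <;> rcases hs₂ with hsk | hsk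
    · -- `s = j₁ = k₁`: the `σ`-edge is shared, `D e = {j₂, k₂}` runs through `τ`
      have hjk : k₁ = j₁ := hsk.symm.trans hsj
      refine false_of_shared_edge I hI hS heDe hevE hτ₁ hτ₂ (s := j₁) (fun x hx => ?_) hDe2 hDe₁ (by rw [← hjk]; exact hDe₂)
      have h := hDeT' hx
      rw [hjk] at h
      simp only [mem_union, mem_insert, mem_singleton] at h ⊢
      rcases h with (h | h) | (h | h)
      exacts [Or.inl h, Or.inr (Or.inl h), Or.inl h, Or.inr (Or.inr h)]
    · -- `s = j₁ = k₂`: `σ ∈ j₁` but `σ ∉ k₂`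
      exact hσk₂ (by rw [← hsk, hsj]; exact hσ₁)
    · -- `s = j₂ = k₁`: `τ ∈ j₂` but `τ ∉ k₁`
      exact hτk₁ (by rw [← hsk, hsj]; exact hτ₁)
    · -- `s = j₂ = k₂`: the `τ`-edge is shared, `D e = {j₁, k₁}` runs through `σ`
      have hjk : k₂ = j₂ := hsk.symm.trans hsj
      refine false_of_shared_edge I hI hS heDe hevE hσ₁ hσ₂ (s := j₂) (fun x hx => ?_) hDe2
        (by rw [pair_comm]; exact hDe₁) (by rw [← hjk, pair_comm]; exact hDe₂)
      have h := hDeT' hx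
      rw [hjk] at h
      simp only [mem_union, mem_insert, mem_singleton] at h ⊢
      rcases h with (h | h) | (h | h)
      exacts [Or.inr (Or.inl h), Or.inl h, Or.inr (Or.inr h), Or.inl h]

/-- **N1 (v2) `GateCasePNorX` HOLDS** (vacuously: `caseP_nor_false`). -/
theorem gateCasePNorX_holds : GateCasePNorX :=
  fun _ _ _ I hI hT hS hB _ _ _ _ _ hD hRA hread hNOR => (caseP_nor_false I hI hT hS hB hD hRA hread hNOR).elim

end Summit.PneNP.PneNP.Theorems.PstarGateCasePNorFinal
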